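import Summits.HodgeConjecture.HodgeConjecture.Theorems.Ring2BindersLocalVHCAtCMPrimitiveEngine
import Literature.AlgebraicGeometry.HodgeTheory.HodgeGenericQbarDescentFiniteMonodromyInputs
import HarnessLib

/-!
# Ring 2 — binder seat b02 (Hodge ladder stage 3): row b08 `LocalVHCAtCM` — the CM GERM of the variational Hodge conjecture,
# the row on which `HC_CM` is load-bearing — IS its part on fibrewise LEFSCHETZ-PRIMITIVE classes of the MIDDLE degree,
# modulo Catanese's theorem (c21) alone; the CM pivot thinned accordingly

HONEST FRAMING: research route conditional on HC_CM; not a corollary; Q11.4-sentence-2 already refuted in dim ≥ 3.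

Cell `pub-hodge-ring2`, binder seat `ring2-b02` (row b02 `Ring2.Hypotheses.AbelianSchemeVHC`, OPEN, do-not-mint). Row **b08** is
`Ring2.Hypotheses.LocalVHCAtCM` (`Theorems/Ring2HypothesesCMPivot.lean`): for `f : 𝒳 ⟶ S` smooth projective of relative dimension
`m`, `𝒳` and `S` quasi-projective, `S` smooth irreducible, a CM abelian fibre `A₀ ≅ 𝒳_{s₀}` on which the global class
`G ∈ H²ᵖ(𝒳(ℂ); ℂ)` is ALGEBRAIC, `G` rational `(p,p)` on every fibre presented as an abelian variety ⟹ `G|_{𝒳_t}` algebraic for `t`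
in a neighbourhood of `s₀`. OPEN; with row b07 (`CMAnchoredFamilies`, Deligne 1982 Prop. 6.1, CITE) it is the CM pivot
`HC_CM ∧ b07 ∧ b08 ⟹ HC_AV` of the dictionary, the one place where `HC_CM` (`Theses.RankFourFaces.CMAbelianHodge`, BY NAME; never
restated, never cited) is consumed and not dominated. The CM-pivot line's `…CMPivotStubLocalVHCAtCM` localised row b08 to the deep
middle `m ≥ 4`, `2 ≤ p ≤ m - 2` granted "all fibres abelian", and recorded that the reduction `p ↦ m - p` of a GLOBAL class "is not
available fibrewise without the theorem of the fixed part and Lefschetz standard for abelian varieties". Parts `…VHCShadow` /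
`…VHCPrimitiveStep` / `…VHCPrimitiveMiddleFamily` of this seat made exactly those available on quasi-projective carriers (Deligne
1968 = Voisin II 4.18, a tree theorem; Lieberman's `A(𝒳_s, K|)`), for row b02. This file carries them over to the germ row b08.

## What is proved (sorry-free; the only Literature named fact displayed is c21 `Motives.catanese2002_abelianFibres_of_abelianFibre`)

* §1 the restricted statements as FILE-LOCAL NOTATIONS (nothing defined or asserted): `LocalVHCAtCMPrimitiveMiddle[From[g]]` = the
  body of `LocalVHCAtCM` with the binders `g ≤ m`, `2 ≤ p`, `2 * p = m` and, for a global class `K` polarising every fibre,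
  "`G|_{𝒳_t}` is `K|_{𝒳_t}`-PRIMITIVE at every `t`" inserted — on a fibre of dimension `2p` that is
  `G|_{𝒳_t} ∈ P^{2p}(𝒳_t, K|) = ker (L_{K|} : H^{2p} → H^{2p+2})`; restrictions from row b08 (trivial direction).
* §2 **THE DEFECT INDUCTION AT A CM POINT** (`eventually_map_fiberι_mem_algebraicClasses_of_localVHCAtCMPrimitiveMiddleFrom`):
  `LocalVHCAtCMPrimitiveMiddleFrom[g]` gives the germ conclusion `∀ᶠ t in 𝓝 s₀` for fibrewise-primitive classes of EVERY Lefschetz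
  defect `d = m - 2p`, `2 ≤ p`, on CM-pointed quasi-projective abelian-fibred carriers of relative dimension `m ≥ g` — padding ONE
  CM ELLIPTIC CURVE `E₀ = ℂ/ℤ[i]` at a time: `𝒳 × E₀ ⟶ S` is again such a carrier (Segre; `A₀ × E₀ ≅ (𝒳 × E₀)_{s₀}` is CM —
  `Milne1999.IsOfCMType.prod` through `CMPivot.isCM_iff_exists_cmSubalgebra`), and the primitive one-step lift
  `W♯ = L_{pr^*K} pr^*W - (r+1) · L_{pr^*K_{E₀}} pr^*W` (`exists_primitiveOneStepLift`, p253550) has defect one less and the SAME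
  algebraicity locus fibre by fibre. Then (`…_of_localVHCAtCMPrimitiveMiddleFrom_of_le`) the engine's filter-form shadow and
  global first Lefschetz step give the germ conclusion in EVERY codimension on such carriers. FACT-FREE.
* §3 **`LocalVHCAtCM ↔ LocalVHCAtCMPrimitiveMiddleFrom[4] ↔ LocalVHCAtCMPrimitiveMiddle` modulo c21**
  (`localVHCAtCM_iff_primitiveMiddleFrom_four_of_catanese2002`): every complex fibre of a CM-pointed family is an abelian variety
  (Catanese 2002 Thm. 4.1/4.6, the refereed named fact c21, exactly on row b08's carriers), so the engine runs. FIRST CELL WITH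
  CONTENT: CM-pointed families of abelian FOURFOLDS, `p = 2`, `G|_{𝒳_t} ∈ P⁴(𝒳_t, K|) = ker (L_{K|} : H⁴ → H⁶)`.
* §4 **THE CM PIVOT, THINNED**: granted row b07 and c21, `HC_AV ↔ HC_CM ∧ LocalVHCAtCMPrimitiveMiddleFrom[4]` and
  `CMToAbelian ↔ (HC_CM → LocalVHCAtCMPrimitiveMiddleFrom[4])` (item 16267); with b07 supplied by print
  (`Deligne1982.deligne1982_cmDenseMumfordTateFamilies`) likewise. So, modulo print, what `HC_CM` must be supplemented by to give
  `HC_AV` is precisely: the variational Hodge conjecture as a germ at a CM fibre, for fibrewise Lefschetz-primitive classes of the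
  middle degree on CM-pointed families of even-dimensional abelian varieties of relative dimension `≥ 4`.

What is NOT claimed: any case of row b08, of `AbelianSchemeVHC` or of HC; anything about `HC_CM` beyond its being a conjunct / the
pivot's hypothesis; Catanese's theorem (displayed as the hypothesis `hC`, KIND CITE, not discharged).

PRESEARCH (required line): «variational Hodge conjecture germ at CM point reduced to primitive middle cohomology» → none
(corpus hybrid + galaxy, see seat NOTES); nearest print: Kerr–Pearlstein 2011 §3.1 (absolute reduction to primitive middle classes
via `X × ℙʳ` and hyperplane sections, which leaves abelian varieties), Charles–Schnell Prop. 11.3.11 (proof; Hilbert-scheme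
countability) ⇒ certification by assembly, nothing new to cite.

References: [Grothendieck1966] footnote 13; [CharlesSchnell2014Notes] Conj. 11.3.1, Cor. 11.3.6, Prop. 11.3.11 (proof), Thm. 11.5.11;
[Deligne1982HodgeCycles] Prop. 6.1, Milne 2003 re-edition endnote 19; [Catanese2002DeformationTypes] §4 Thm. 4.1, Thm. 4.6;
[VoisinHodgeI2002] §6.2.3 Def. 6.24, Thm. 6.25, Cor. 6.26, Rem. 6.27, §7.1.2; [VoisinHodgeII2003] Lemma 4.17, Thm. 4.18;
[KerrPearlstein2011] §3.1; [Lieberman1968] main theorem; [MumfordAV1970] §19 Thm. 3, §22; [Milne1999] §2 p. 54;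
[SilvermanAEC2009] Thm. VI.4.1 (b).
-/

-- every declaration of this problem lives in `Summit.HodgeConjecture.HodgeConjecture.…` (summit = sub-problem);
-- namespace `…Ring2.Binders` = the binder seats of the cell's Hodge-ladder stage 3 (`BINDER-OWNERS.md`)
set_option linter.dupNamespace false

noncomputable section

open CategoryTheory CategoryTheory.Limits AlgebraicGeometry Topology Filter MonoidalCategory CartesianMonoidalCategory
open Literature.AlgebraicGeometry Literature.AlgebraicGeometry.Motives
open Literature.AlgebraicGeometry.HodgeTheory
open Literature.AlgebraicGeometry.Milne1999 (IsOfCMType)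
open Literature.AlgebraicGeometry.Deligne1982 (deligne1982_cmDenseMumfordTateFamilies)

namespace Summit.HodgeConjecture.HodgeConjecture.Ring2.Binders

open Summit.HodgeConjecture.HodgeConjecture.Ring2.Hypotheses

/-! ## §1 The restricted germ statements (file-local notations; nothing is defined or asserted) -/

/-- `IsCM[A]` — CM type in the eigenvalue typing (verbatim `Theorems/Ring2HypothesesCMPivot.lean`). Local notation only. -/
local notation3 (prettyPrint := false) "IsCM[" A "]" =>
  ∃ (ψ : A ⟶ A) (μ : Fin (2 * AbelianVariety.dim A) → ℂ), Function.Injective μ ∧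
    ∀ i, Module.End.HasEigenvalue (HodgeTheory.complexBetti.map ψ.hom.hom.hom 1).hom (μ i)

/-- `QProj[X]` — `X` quasi-projective over `ℂ` (verbatim `Theorems/Ring2HypothesesCMPivot.lean`; the inlined body of
`HodgeTheory.IsQuasiProjectiveOver X`). Local notation only. -/
local notation3 (prettyPrint := false) "QProj[" X "]" =>
  ∃ (P : SchemeOver ℂ) (j : X ⟶ P), IsProjectiveOver P ∧ AlgebraicGeometry.IsOpenImmersion j.left

/-- `FibreIncl[f, B, e, s]` — `e` presents `B` as the fibre of `f` over `s` (verbatim `Theorems/Ring2HypothesesCMPivot.lean`).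
Local notation only. -/
local notation3 (prettyPrint := false) "FibreIncl[" f ", " B ", " e ", " s "]" =>
  ∃ i : AbelianVariety.X B ≅ fiberOver f s, e = CategoryStruct.comp i.hom (fiberι f s)

/-- `HodgeAlong[S, 𝒳, f, G, p]` — `G` is rational `(p,p)` on every fibre presented as an abelian variety (verbatim
`Theorems/Ring2HypothesesCMPivot.lean`). Local notation only. -/
local notation3 (prettyPrint := false) "HodgeAlong[" S ", " 𝒳 ", " f ", " G ", " p "]" =>
  ∀ (B : AbelianVariety ℂ) (eB : AbelianVariety.X B ⟶ 𝒳) (u : ComplexPoints S),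
    FibreIncl[f, B, eB, u] →
      HodgeTheory.IsRationalClass (HodgeTheory.complexBetti.map eB (2 * p) G) ∧
      HodgeTheory.IsOfHodgeType B.dim B.X (2 * p) p p (HodgeTheory.complexBetti.map eB (2 * p) G)

/-- **Row b08 restricted to fibrewise LEFSCHETZ-PRIMITIVE classes of the MIDDLE degree** (file-local notation; symbol for symbol
the body of `Ring2.Hypotheses.LocalVHCAtCM` with the binders `2 ≤ p`, `2 * p = m` inserted after the binder list and, after the
Hodge clause, a global class `K` polarising every fibre `𝒳_t` together with "`G|_{𝒳_t}` is `K|_{𝒳_t}`-primitive at every `t`"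
— on a fibre of dimension `2p` that is `G|_{𝒳_t} ∈ P^{2p}(𝒳_t, K|) = ker (L_{K|} : H^{2p} → H^{2p+2})`). -/
local notation3 (prettyPrint := false) "LocalVHCAtCMPrimitiveMiddle" =>
  ∀ (S 𝒳 : SchemeOver ℂ) (f : 𝒳 ⟶ S) (m p : ℕ) (G : HodgeTheory.complexBetti 𝒳 (2 * p))
    (s₀ : ComplexPoints S) (A₀ : AbelianVariety ℂ) (e₀ : A₀.X ⟶ 𝒳),
    2 ≤ p → 2 * p = m →
    QProj[𝒳] → QProj[S] → AlgebraicGeometry.Smooth S.hom → IrreducibleSpace S.left →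
    IsSmoothProjectiveFamily f m →
    FibreIncl[f, A₀, e₀, s₀] → IsCM[A₀] →
    HodgeTheory.complexBetti.map e₀ (2 * p) G ∈ HodgeTheory.algebraicClasses A₀.X p →
    HodgeAlong[S, 𝒳, f, G, p] →
    ∀ (K : HodgeTheory.complexBetti 𝒳 2),
      (∀ t : ComplexPoints S,
        HodgeTheory.IsPolarizationClass m (fiberOver f t) (HodgeTheory.complexBetti.map (fiberι f t) 2 K)) →
      (∀ t : ComplexPoints S, HodgeTheory.complexBetti.map (fiberι f t) (2 * p) G ∈
        HodgeTheory.primitiveClasses (HodgeTheory.complexBetti.map (fiberι f t) 2 K) m (2 * p)) →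
    ∃ U : Set (ComplexPoints S), IsOpen U ∧ s₀ ∈ U ∧ ∀ t ∈ U,
      HodgeTheory.complexBetti.map (fiberι f t) (2 * p) G ∈
        HodgeTheory.algebraicClasses (fiberOver f t) p

/-- The same from relative dimension `g` on (file-local notation; the binder `g ≤ m` inserted first): the cells `(2q, q)`,
`2q ≥ g`, of row b08, restricted to fibrewise-primitive classes. -/
local notation3 (prettyPrint := false) "LocalVHCAtCMPrimitiveMiddleFrom[" g "]" =>
  ∀ (S 𝒳 : SchemeOver ℂ) (f : 𝒳 ⟶ S) (m p : ℕ) (G : HodgeTheory.complexBetti 𝒳 (2 * p))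
    (s₀ : ComplexPoints S) (A₀ : AbelianVariety ℂ) (e₀ : A₀.X ⟶ 𝒳),
    g ≤ m → 2 ≤ p → 2 * p = m →
    QProj[𝒳] → QProj[S] → AlgebraicGeometry.Smooth S.hom → IrreducibleSpace S.left →
    IsSmoothProjectiveFamily f m →
    FibreIncl[f, A₀, e₀, s₀] → IsCM[A₀] →
    HodgeTheory.complexBetti.map e₀ (2 * p) G ∈ HodgeTheory.algebraicClasses A₀.X p →
    HodgeAlong[S, 𝒳, f, G, p] →
    ∀ (K : HodgeTheory.complexBetti 𝒳 2),
      (∀ t : ComplexPoints S,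
        HodgeTheory.IsPolarizationClass m (fiberOver f t) (HodgeTheory.complexBetti.map (fiberι f t) 2 K)) →
      (∀ t : ComplexPoints S, HodgeTheory.complexBetti.map (fiberι f t) (2 * p) G ∈
        HodgeTheory.primitiveClasses (HodgeTheory.complexBetti.map (fiberι f t) 2 K) m (2 * p)) →
    ∃ U : Set (ComplexPoints S), IsOpen U ∧ s₀ ∈ U ∧ ∀ t ∈ U,
      HodgeTheory.complexBetti.map (fiberι f t) (2 * p) G ∈
        HodgeTheory.algebraicClasses (fiberOver f t) p

/-- Restriction: row b08 gives its primitive-middle part. [cite: CharlesSchnell2014Notes, Conj. 11.3.1] -/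
theorem localVHCAtCMPrimitiveMiddle_of_localVHCAtCM (h : LocalVHCAtCM) : LocalVHCAtCMPrimitiveMiddle :=
  fun S 𝒳 f m p G s₀ A₀ e₀ _ _ h𝒳 hS hsm hirr hf hA₀ hcm halg hG _ _ _ =>
    h S 𝒳 f m p G s₀ A₀ e₀ h𝒳 hS hsm hirr hf hA₀ hcm halg hG

/-- Restriction: the primitive-middle part gives its slice from relative dimension `g` on. [cite: CharlesSchnell2014Notes, Conj. 11.3.1] -/
theorem localVHCAtCMPrimitiveMiddleFrom_of_primitiveMiddle (g : ℕ) (h : LocalVHCAtCMPrimitiveMiddle) :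
    LocalVHCAtCMPrimitiveMiddleFrom[g] :=
  fun S 𝒳 f m p G s₀ A₀ e₀ _ h2 hpm => h S 𝒳 f m p G s₀ A₀ e₀ h2 hpm

/-- Restriction: row b08 gives its primitive-middle part from relative dimension `g` on. [cite: CharlesSchnell2014Notes, Conj. 11.3.1] -/
theorem localVHCAtCMPrimitiveMiddleFrom_of_localVHCAtCM (g : ℕ) (h : LocalVHCAtCM) : LocalVHCAtCMPrimitiveMiddleFrom[g] :=
  localVHCAtCMPrimitiveMiddleFrom_of_primitiveMiddle g (localVHCAtCMPrimitiveMiddle_of_localVHCAtCM h)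

/-! ## §2 The defect induction at a CM point, and the germ conclusion in every codimension (carrier level, fact-free) -/

section Defect

variable {𝒳 S : SchemeOver ℂ}

/-- **THE DEFECT INDUCTION AT A CM POINT.** If row b08 holds for fibrewise-primitive MIDDLE classes on CM-pointed families of
relative dimension `≥ g`, then on every smooth projective family `f : 𝒳 ⟶ S` of relative dimension `m ≥ g` with quasi-projective
total space over a smooth irreducible quasi-projective base, all complex fibres abelian varieties, a CM abelian fibre
`A₀ ≅ 𝒳_{s₀}`, and every global class `K` polarising the fibres: a global class `W ∈ H²ᵖ`, `2 ≤ p`, fibrewise rational `(p,p)` and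
fibrewise `K|`-PRIMITIVE of ANY defect `d = m - 2p`, algebraic on `𝒳_{s₀}`, is algebraic on `𝒳_t` for all `t` near `s₀`. Induction
on `d`: `d = 0` is the hypothesis (the CM-pivot typing read on the fibres, engine §3); for `d = r + 1` pad by the CM elliptic curve
`E₀` (`exists_dim_eq_one_isOfCMType`): `𝒳 × E₀ ⟶ S` has quasi-projective total space (Segre), abelian fibres, relative dimension
`m + 1 ≥ g`, the CM fibre `A₀ × E₀ ≅ (𝒳 × E₀)_{s₀}` (`isCM_prod_of_isCM_of_isOfCMType`), and the primitive one-step lift `W♯` of `W`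
(`exists_primitiveOneStepLift`: fibrewise rational `(p+1,p+1)`, `K♯|`-primitive of defect `r`, SAME algebraicity locus) — to which
the induction hypothesis applies AT THE SAME POINT `s₀`. FACT-FREE. [cite: VoisinHodgeI2002, §6.2.3 Def. 6.24, Cor. 6.26 and Rem. 6.27]
[cite: Kleiman1968AlgebraicCycles, Thm. 2.9 and Thm. 2A11] [cite: Lieberman1968, main theorem] [cite: Milne1999, §2 p. 54]
[cite: MumfordAV1970, §22] [cite: CharlesSchnell2014Notes, Conj. 11.3.1 and Prop. 11.3.11 (proof)] -/
theorem eventually_map_fiberι_mem_algebraicClasses_of_localVHCAtCMPrimitiveMiddleFrom {g : ℕ}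
    (h : LocalVHCAtCMPrimitiveMiddleFrom[g]) (d : ℕ) :
    ∀ ⦃m : ℕ⦄ ⦃𝒳 S : SchemeOver ℂ⦄ (f : 𝒳 ⟶ S) (s₀ : ComplexPoints S) (A₀ : AbelianVariety ℂ),
      IsQuasiProjectiveOver 𝒳 → IsQuasiProjectiveOver S → AlgebraicGeometry.Smooth S.hom → IrreducibleSpace S.left →
      IsSmoothProjectiveFamily f m → g ≤ m → Nonempty (A₀.X ≅ fiberOver f s₀) → IsCM[A₀] →
      (∀ s : ComplexPoints S, ∃ A' : AbelianVariety ℂ, A'.dim = m ∧ Nonempty (A'.X ≅ fiberOver f s)) →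
      ∀ (K : complexBetti 𝒳 2),
        (∀ s : ComplexPoints S, IsPolarizationClass m (fiberOver f s) (complexBetti.map (fiberι f s) 2 K)) →
      ∀ (p : ℕ), 2 ≤ p → 2 * p + d = m → ∀ (W : complexBetti 𝒳 (2 * p)),
        (∀ s : ComplexPoints S, IsRationalClass (complexBetti.map (fiberι f s) (2 * p) W) ∧
          IsOfHodgeType m (fiberOver f s) (2 * p) p p (complexBetti.map (fiberι f s) (2 * p) W)) →
        (∀ s : ComplexPoints S, complexBetti.map (fiberι f s) (2 * p) W ∈
          primitiveClasses (complexBetti.map (fiberι f s) 2 K) m (2 * p)) →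
        complexBetti.map (fiberι f s₀) (2 * p) W ∈ algebraicClasses (fiberOver f s₀) p →
        ∀ᶠ t in 𝓝 s₀, complexBetti.map (fiberι f t) (2 * p) W ∈ algebraicClasses (fiberOver f t) p := by
  induction d with
  | zero =>
    intro m 𝒳 S f s₀ A₀ h𝒳 hS hSs hirr hf hgm hA₀ hCM habel K hK p h2 hpm W hW hP h₀
    obtain ⟨i₀⟩ := hA₀
    obtain ⟨U, hUo, hU₀, hU⟩ := h S 𝒳 f m p W s₀ A₀ (i₀.hom ≫ fiberι f s₀) hgm h2 (by omega) h𝒳 hS hSs hirr hf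
      ⟨i₀, rfl⟩ hCM ((map_comp_fiberι_mem_algebraicClasses_iff f i₀ W).2 h₀)
      (hodgeAlong_of_forall_isRationalClass_and_isOfHodgeType f hf W hW) K hK hP
    exact eventually_nhds_iff.2 ⟨U, hU, hUo, hU₀⟩
  | succ r ih =>
    intro m 𝒳 S f s₀ A₀ h𝒳 hS hSs hirr hf hgm hA₀ hCM habel K hK p h2 hpm W hW hP h₀
    obtain ⟨i₀⟩ := hA₀
    obtain ⟨E, hE1, hEcm⟩ := exists_dim_eq_one_isOfCMType
    obtain ⟨K_E, hKE⟩ := exists_isPolarizationClass (AbelianVariety.isSmoothProjective_holds (A := E))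
    obtain ⟨hf', habel', K', W', hK', hW', hP', hiff⟩ := exists_primitiveOneStepLift f hf habel K hK E hE1 hKE hpm W hW hP
    have h𝒳' : IsQuasiProjectiveOver (𝒳 ⊗ E.X) := isQuasiProjectiveOver_tensorObj_of_field h𝒳
      (IsQuasiProjectiveOver.of_isProjectiveOver (AbelianVariety.isSmoothProjective_holds (A := E)).isProjectiveOver)
    exact (ih (fst 𝒳 E.X ≫ f) s₀ (A₀.prod E) h𝒳' hS hSs hirr hf' (by omega) (nonempty_prod_iso_fiberOver_fst_comp f i₀ E)
      (isCM_prod_of_isCM_of_isOfCMType hCM hEcm) habel' K' hK' (p + 1) (by omega) (by omega) W' hW' hP'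
      ((hiff s₀).2 h₀)).mono fun t ht ↦ (hiff t).1 ht

/-- **The primitive-middle germ from relative dimension `g` on gives the germ conclusion in EVERY codimension on CM-pointed
quasi-projective abelian-fibred carriers of relative dimension `m ≥ g` — FACT-FREE**: the engine's filter-form reductions at
`l = 𝓝 s₀` (shadow above the middle, global first Lefschetz step inside a degree, with the shadow part's one global polarising class)
fed with the defect induction. [cite: KerrPearlstein2011, §3.1] [cite: VoisinHodgeII2003, Thm. 4.18] [cite: VoisinHodgeI2002, Thm. 6.25,
Cor. 6.26 and Rem. 6.27] [cite: Lieberman1968, main theorem] [cite: CharlesSchnell2014Notes, Conj. 11.3.1 and Prop. 11.3.11 (proof)] -/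
theorem eventually_map_fiberι_mem_algebraicClasses_of_localVHCAtCMPrimitiveMiddleFrom_of_le {g : ℕ}
    (h : LocalVHCAtCMPrimitiveMiddleFrom[g]) (f : 𝒳 ⟶ S) {m : ℕ} (hf : IsSmoothProjectiveFamily f m) (hgm : g ≤ m)
    (h𝒳 : IsQuasiProjectiveOver 𝒳) (hS : IsQuasiProjectiveOver S) [IrreducibleSpace S.left]
    (hSs : AlgebraicGeometry.Smooth S.hom) {s₀ : ComplexPoints S} {A₀ : AbelianVariety ℂ}
    (hA₀ : Nonempty (A₀.X ≅ fiberOver f s₀)) (hCM : IsCM[A₀])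
    (hA : ∀ s : ComplexPoints S, ∃ A' : AbelianVariety ℂ, A'.dim = m ∧ Nonempty (A'.X ≅ fiberOver f s))
    (p : ℕ) (W : complexBetti 𝒳 (2 * p))
    (hW : ∀ s : ComplexPoints S, IsRationalClass (complexBetti.map (fiberι f s) (2 * p) W) ∧
      IsOfHodgeType m (fiberOver f s) (2 * p) p p (complexBetti.map (fiberι f s) (2 * p) W))
    (h₀ : complexBetti.map (fiberι f s₀) (2 * p) W ∈ algebraicClasses (fiberOver f s₀) p) :
    ∀ᶠ t in 𝓝 s₀, complexBetti.map (fiberι f t) (2 * p) W ∈ algebraicClasses (fiberOver f t) p := by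
  haveI : IsSeparated S.hom := hS.isSeparated
  obtain ⟨K, hK⟩ := exists_forall_isPolarizationClass_map_fiberι f hf h𝒳
  exact eventually_map_fiberι_mem_algebraicClasses_of_forall_mem_primitiveClasses f hf h𝒳 hS hSs hA K hK (𝓝 s₀)
    (fun q h2 hq W' hW' hP h₀' ↦ eventually_map_fiberι_mem_algebraicClasses_of_localVHCAtCMPrimitiveMiddleFrom h (m - 2 * q)
      f s₀ A₀ h𝒳 hS hSs ‹_› hf hgm hA₀ hCM hA K hK q h2 (by omega) W' hW' hP h₀') p W hW h₀

/-- **The primitive-middle germ from relative dimension `4` on gives the germ conclusion in every codimension on EVERY CM-pointed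
quasi-projective abelian-fibred carrier** (any relative dimension: below `4` the primitive instances of codimension `2 ≤ q ≤ m/2`
asked for by the Lefschetz step are void, and the engine closes on its own — Lefschetz `(1,1)`, points, the shadow). FACT-FREE.
[cite: KerrPearlstein2011, §3.1] [cite: VoisinHodgeII2003, Thm. 4.18 and §10.2.3] [cite: Lieberman1968, main theorem] -/
theorem eventually_map_fiberι_mem_algebraicClasses_of_localVHCAtCMPrimitiveMiddleFrom_four
    (h : LocalVHCAtCMPrimitiveMiddleFrom[4]) (f : 𝒳 ⟶ S) {m : ℕ} (hf : IsSmoothProjectiveFamily f m)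
    (h𝒳 : IsQuasiProjectiveOver 𝒳) (hS : IsQuasiProjectiveOver S) [IrreducibleSpace S.left]
    (hSs : AlgebraicGeometry.Smooth S.hom) {s₀ : ComplexPoints S} {A₀ : AbelianVariety ℂ}
    (hA₀ : Nonempty (A₀.X ≅ fiberOver f s₀)) (hCM : IsCM[A₀])
    (hA : ∀ s : ComplexPoints S, ∃ A' : AbelianVariety ℂ, A'.dim = m ∧ Nonempty (A'.X ≅ fiberOver f s))
    (p : ℕ) (W : complexBetti 𝒳 (2 * p))
    (hW : ∀ s : ComplexPoints S, IsRationalClass (complexBetti.map (fiberι f s) (2 * p) W) ∧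
      IsOfHodgeType m (fiberOver f s) (2 * p) p p (complexBetti.map (fiberι f s) (2 * p) W))
    (h₀ : complexBetti.map (fiberι f s₀) (2 * p) W ∈ algebraicClasses (fiberOver f s₀) p) :
    ∀ᶠ t in 𝓝 s₀, complexBetti.map (fiberι f t) (2 * p) W ∈ algebraicClasses (fiberOver f t) p := by
  by_cases hm : 4 ≤ m
  · exact eventually_map_fiberι_mem_algebraicClasses_of_localVHCAtCMPrimitiveMiddleFrom_of_le h f hf hm h𝒳 hS hSs hA₀ hCM hA
      p W hW h₀
  · haveI : IsSeparated S.hom := hS.isSeparated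
    obtain ⟨K, hK⟩ := exists_forall_isPolarizationClass_map_fiberι f hf h𝒳
    exact eventually_map_fiberι_mem_algebraicClasses_of_forall_mem_primitiveClasses f hf h𝒳 hS hSs hA K hK (𝓝 s₀)
      (fun q h2 hq ↦ absurd hq (by omega)) p W hW h₀

end Defect

/-! ## §3 The binder: row b08 IS its fibrewise-primitive middle-degree part, modulo Catanese's theorem (c21) -/

/-- **`LocalVHCAtCMPrimitiveMiddleFrom[4] ∧ c21 ⟹ LocalVHCAtCM`** — the content direction. In row b08's own typing: the anchor
is moved to THE fibre `𝒳_{s₀}` along the chart; every complex fibre is an abelian variety of dimension `dim A₀ = m` by Catanese's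
theorem (`Motives.catanese2002_abelianFibres_of_abelianFibre`, exactly on row b08's carriers); `HodgeAlong` is read on the fibres;
§2 gives `∀ᶠ t in 𝓝 s₀`, i.e. an open `U ∋ s₀`. CONDITIONAL on c21 only (displayed as `hC`).
[cite: Catanese2002DeformationTypes, §4 Thm. 4.1 and Thm. 4.6] [cite: CharlesSchnell2014Notes, Conj. 11.3.1 and Prop. 11.3.11 (proof)]
[cite: KerrPearlstein2011, §3.1] [cite: Lieberman1968, main theorem] -/
theorem localVHCAtCM_of_primitiveMiddleFrom_four_of_catanese2002 (hC : catanese2002_abelianFibres_of_abelianFibre)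
    (h : LocalVHCAtCMPrimitiveMiddleFrom[4]) : LocalVHCAtCM := by
  intro S 𝒳 f m p G s₀ A₀ e₀ h𝒳 hS hsm hirr hf hA₀ hcm halg hG
  obtain ⟨i₀, hi₀⟩ := hA₀
  haveI := hirr
  -- the anchor on THE fibre `𝒳_{s₀}`
  rw [hi₀] at halg
  have halg₀ : complexBetti.map (fiberι f s₀) (2 * p) G ∈ algebraicClasses (fiberOver f s₀) p :=
    (map_comp_fiberι_mem_algebraicClasses_iff f i₀ G).1 halg
  -- every fibre is an abelian variety (Catanese), of dimension `dim A₀ = m`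
  have hdim : A₀.dim = m := dim_eq_of_iso_fiberOver hf i₀
  have hfam : IsSmoothProjectiveFamily f A₀.dim := hdim ▸ hf
  have hA : ∀ t : ComplexPoints S, ∃ B : AbelianVariety ℂ, B.dim = m ∧ Nonempty (B.X ≅ fiberOver f t) := fun t => by
    obtain ⟨B, hB, hBt⟩ := hC f A₀ h𝒳 hS hirr hsm hfam ⟨s₀, ⟨i₀⟩⟩ t
    exact ⟨B, hB.trans hdim, hBt⟩
  -- the Hodge clause read on the fibres
  have hW := forall_isRationalClass_and_isOfHodgeType_of_hodgeAlong f hf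
    ((abelianFibres_iff_of_isSmoothProjectiveFamily hf).1 hA) G hG
  obtain ⟨U, hU, hUo, hU₀⟩ := eventually_nhds_iff.1
    (eventually_map_fiberι_mem_algebraicClasses_of_localVHCAtCMPrimitiveMiddleFrom_four h f hf h𝒳 hS hsm ⟨i₀⟩ hcm hA p G
      hW halg₀)
  exact ⟨U, hUo, hU₀, hU⟩

/-- **ROW b08 ⟺ ITS FIBREWISE-PRIMITIVE MIDDLE-DEGREE PART FROM RELATIVE DIMENSION `4` ON, modulo Catanese (c21, used in `←`)**:
the variational Hodge conjecture as a germ at a CM fibre IS, in the kernel, the same germ for fibrewise LEFSCHETZ-PRIMITIVE classes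
`G|_{𝒳_t} ∈ P^{2p}(𝒳_t, K|)` of the middle degree on CM-pointed families of abelian varieties of even relative dimension `2p ≥ 4`
(first cell: abelian FOURFOLD families, `G|_{𝒳_t} ∈ ker (L_{K|} : H⁴ → H⁶)`). [cite: Catanese2002DeformationTypes, §4 Thm. 4.1 and Thm. 4.6]
[cite: KerrPearlstein2011, §3.1] [cite: VoisinHodgeII2003, Thm. 4.18] [cite: Lieberman1968, main theorem] -/
theorem localVHCAtCM_iff_primitiveMiddleFrom_four_of_catanese2002 (hC : catanese2002_abelianFibres_of_abelianFibre) :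
    LocalVHCAtCM ↔ LocalVHCAtCMPrimitiveMiddleFrom[4] :=
  ⟨localVHCAtCMPrimitiveMiddleFrom_of_localVHCAtCM 4, localVHCAtCM_of_primitiveMiddleFrom_four_of_catanese2002 hC⟩

/-- **Row b08 ⟺ `LocalVHCAtCMPrimitiveMiddle`** (every even relative dimension) modulo Catanese (c21, in `←`).
[cite: Catanese2002DeformationTypes, §4 Thm. 4.1 and Thm. 4.6] [cite: KerrPearlstein2011, §3.1] -/
theorem localVHCAtCM_iff_primitiveMiddle_of_catanese2002 (hC : catanese2002_abelianFibres_of_abelianFibre) :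
    LocalVHCAtCM ↔ LocalVHCAtCMPrimitiveMiddle :=
  ⟨localVHCAtCMPrimitiveMiddle_of_localVHCAtCM, fun h ↦ localVHCAtCM_of_primitiveMiddleFrom_four_of_catanese2002 hC
    (localVHCAtCMPrimitiveMiddleFrom_of_primitiveMiddle 4 h)⟩

/-- **ON-PATH for the restricted row: `HC_AV ∧ c21 ⟹ LocalVHCAtCMPrimitiveMiddleFrom[g]`** (through the CM-germ part's
`localVHCAtCM_of_hc_av_of_catanese2002` and restriction). [cite: CharlesSchnell2014Notes, Cor. 11.3.6]
[cite: Catanese2002DeformationTypes, §4 Thm. 4.1 and Thm. 4.6] -/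
theorem localVHCAtCMPrimitiveMiddleFrom_of_hc_av_of_catanese2002 (g : ℕ) (hC : catanese2002_abelianFibres_of_abelianFibre)
    (h : Theses.PadicSemiregularLift.HodgeAbelianVarieties) : LocalVHCAtCMPrimitiveMiddleFrom[g] :=
  localVHCAtCMPrimitiveMiddleFrom_of_localVHCAtCM g (localVHCAtCM_of_hc_av_of_catanese2002 hC h)

/-! ## §4 The CM pivot, thinned: `HC_CM ∧ b07 ∧ b08↾(primitive middle, from 4) ⟹ HC_AV`, and exactness, modulo c21 -/

/-- **The CM pivot with the thinner germ row: `HC_CM ∧ CMAnchoredFamilies ∧ LocalVHCAtCMPrimitiveMiddleFrom[4] ∧ c21 ⟹ HC_AV`**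
— the dictionary's `hc_av_of_hc_cm_of_cmAnchoredFamilies_of_localVHCAtCM` fed with §3. `HC_CM` =
`Theses.RankFourFaces.CMAbelianHodge` BY NAME (the anchor at the CM fibre), load-bearing, not dominated; b07 CITE (Deligne 1982
Prop. 6.1); c21 CITE. [cite: Deligne1982HodgeCycles, Prop. 6.1] [cite: CharlesSchnell2014Notes, Thm. 11.5.11 and proof of Prop. 11.3.11]
[cite: Catanese2002DeformationTypes, §4 Thm. 4.1 and Thm. 4.6] -/
theorem hc_av_of_hc_cm_of_cmAnchoredFamilies_of_localVHCAtCMPrimitiveMiddleFrom_four_of_catanese2002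
    (hC : catanese2002_abelianFibres_of_abelianFibre) (hCM : Theses.RankFourFaces.CMAbelianHodge) (hMT : CMAnchoredFamilies)
    (hV : LocalVHCAtCMPrimitiveMiddleFrom[4]) : Theses.PadicSemiregularLift.HodgeAbelianVarieties :=
  hc_av_of_hc_cm_of_cmAnchoredFamilies_of_localVHCAtCM hCM hMT (localVHCAtCM_of_primitiveMiddleFrom_four_of_catanese2002 hC hV)

/-- **EXACTNESS OF THE THINNED PIVOT: granted row b07 and c21, `HC_AV ↔ HC_CM ∧ LocalVHCAtCMPrimitiveMiddleFrom[4]`.** Modulo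
print, what `HC_CM` must be supplemented by to give `HC_AV` is PRECISELY the germ at a CM fibre of the variational Hodge conjecture
for fibrewise Lefschetz-primitive middle classes on CM-pointed families of abelian varieties of even relative dimension `≥ 4`.
`HC_CM` is a conjunct of one side; nothing about it is decided. [cite: Deligne1982HodgeCycles, Prop. 6.1]
[cite: CharlesSchnell2014Notes, Cor. 11.3.6 and proof of Prop. 11.3.11] [cite: Catanese2002DeformationTypes, §4 Thm. 4.1 and Thm. 4.6] -/
theorem hc_av_iff_hc_cm_and_localVHCAtCMPrimitiveMiddleFrom_four_of_cmAnchoredFamilies_of_catanese2002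
    (hC : catanese2002_abelianFibres_of_abelianFibre) (hMT : CMAnchoredFamilies) :
    Theses.PadicSemiregularLift.HodgeAbelianVarieties ↔
      Theses.RankFourFaces.CMAbelianHodge ∧ LocalVHCAtCMPrimitiveMiddleFrom[4] :=
  (hc_av_iff_hc_cm_and_localVHCAtCM_of_cmAnchoredFamilies_of_catanese2002 hC hMT).trans
    (and_congr_right fun _ ↦ localVHCAtCM_iff_primitiveMiddleFrom_four_of_catanese2002 hC)

/-- **Item-16267 form: granted row b07 and c21, `CMToAbelian ↔ (HC_CM → LocalVHCAtCMPrimitiveMiddleFrom[4])`.**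
[cite: Deligne1982HodgeCycles, Prop. 6.1] [cite: CharlesSchnell2014Notes, Cor. 11.3.6 and proof of Prop. 11.3.11]
[cite: Catanese2002DeformationTypes, §4 Thm. 4.1 and Thm. 4.6] -/
theorem cmToAbelian_iff_localVHCAtCMPrimitiveMiddleFrom_four_of_hc_cm_of_cmAnchoredFamilies_of_catanese2002
    (hC : catanese2002_abelianFibres_of_abelianFibre) (hMT : CMAnchoredFamilies) :
    Theses.RankFourFaces.CMToAbelian ↔ (Theses.RankFourFaces.CMAbelianHodge → LocalVHCAtCMPrimitiveMiddleFrom[4]) :=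
  (cmToAbelian_iff_localVHCAtCM_of_hc_cm_of_cmAnchoredFamilies_of_catanese2002 hC hMT).trans
    (imp_congr_right fun _ ↦ localVHCAtCM_iff_primitiveMiddleFrom_four_of_catanese2002 hC)

/-- **The thinned exactness with row b07 supplied by print** (Deligne 1982 Prop. 6.1 in the dense form of Charles–Schnell
Thm. 11.5.11, the refereed fact `Deligne1982.deligne1982_cmDenseMumfordTateFamilies`, through
`Ring2.Deform.cmAnchoredFamilies_of_deligne1982`) and c21: `HC_AV ↔ HC_CM ∧ LocalVHCAtCMPrimitiveMiddleFrom[4]`.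
[cite: Deligne1982HodgeCycles, Prop. 6.1] [cite: CharlesSchnell2014Notes, Thm. 11.5.11] [cite: Catanese2002DeformationTypes, §4 Thm. 4.1 and Thm. 4.6] -/
theorem hc_av_iff_hc_cm_and_localVHCAtCMPrimitiveMiddleFrom_four_of_deligne1982_of_catanese2002
    (hD : deligne1982_cmDenseMumfordTateFamilies) (hC : catanese2002_abelianFibres_of_abelianFibre) :
    Theses.PadicSemiregularLift.HodgeAbelianVarieties ↔
      Theses.RankFourFaces.CMAbelianHodge ∧ LocalVHCAtCMPrimitiveMiddleFrom[4] :=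
  hc_av_iff_hc_cm_and_localVHCAtCMPrimitiveMiddleFrom_four_of_cmAnchoredFamilies_of_catanese2002 hC
    (Ring2.Deform.cmAnchoredFamilies_of_deligne1982 hD)

/-- Item-16267 form with row b07 supplied by print: `CMToAbelian ↔ (HC_CM → LocalVHCAtCMPrimitiveMiddleFrom[4])` granted Deligne 1982
Prop. 6.1 (dense form) and c21. [cite: Deligne1982HodgeCycles, Prop. 6.1] [cite: CharlesSchnell2014Notes, Thm. 11.5.11]
[cite: Catanese2002DeformationTypes, §4 Thm. 4.1 and Thm. 4.6] -/
theorem cmToAbelian_iff_localVHCAtCMPrimitiveMiddleFrom_four_of_hc_cm_of_deligne1982_of_catanese2002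
    (hD : deligne1982_cmDenseMumfordTateFamilies) (hC : catanese2002_abelianFibres_of_abelianFibre) :
    Theses.RankFourFaces.CMToAbelian ↔ (Theses.RankFourFaces.CMAbelianHodge → LocalVHCAtCMPrimitiveMiddleFrom[4]) :=
  cmToAbelian_iff_localVHCAtCMPrimitiveMiddleFrom_four_of_hc_cm_of_cmAnchoredFamilies_of_catanese2002 hC
    (Ring2.Deform.cmAnchoredFamilies_of_deligne1982 hD)

/-! ## Audit: what the kernel now says about row b08

`LocalVHCAtCMPrimitiveMiddleFrom[g] →` the germ conclusion on every CM-pointed quasi-projective abelian-fibred carrier of relative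
dimension `≥ g`, every codimension, FACT-FREE (§2); `LocalVHCAtCM ↔ LocalVHCAtCMPrimitiveMiddleFrom[4] ↔ LocalVHCAtCMPrimitiveMiddle`
modulo c21 displayed as a hypothesis (§3); `HC_AV ↔ HC_CM ∧ LocalVHCAtCMPrimitiveMiddleFrom[4]` modulo {b07, c21} (§4). `HC_CM` =
`Theses.RankFourFaces.CMAbelianHodge` occurs by name only, as a conjunct of a side of an `↔` or as the pivot's hypothesis; b07, c21
and `Deligne1982.deligne1982_cmDenseMumfordTateFamilies` enter as hypotheses only. No `sorry`, no new `def`. Closures below are the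
three standard axioms. -/

#print axioms Summit.HodgeConjecture.HodgeConjecture.Ring2.Binders.eventually_map_fiberι_mem_algebraicClasses_of_localVHCAtCMPrimitiveMiddleFrom
#print axioms Summit.HodgeConjecture.HodgeConjecture.Ring2.Binders.localVHCAtCM_iff_primitiveMiddleFrom_four_of_catanese2002
#print axioms Summit.HodgeConjecture.HodgeConjecture.Ring2.Binders.hc_av_iff_hc_cm_and_localVHCAtCMPrimitiveMiddleFrom_four_of_cmAnchoredFamilies_of_catanese2002

end Summit.HodgeConjecture.HodgeConjecture.Ring2.Binders

end
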